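import Mathlib
import Summits.ResolutionOfSingularities.ResolutionOfSingularities.Theorems.HomologicalConductorNoZenoFullSheafHomEquiv
import Summits.ResolutionOfSingularities.ResolutionOfSingularities.Theorems.HomologicalConductorNoZenoFullSheafFree
import HarnessLib

/-!
# Crux `NoZenoR` (stmt-ResolutionOfSingularities-19943), line `sandwich-cluster`, G-layer G2:
# the full sheaf of the free module `T^n` is `𝒪_X^n`, compatibly with presentations

OURS (cell res-hironaka, chain W4.4; KERNEL-L0 §16 R6 row G2 «full-sheaf package», holder
res-D-pv-045 AS res-L0-w44-stub-8; plan `D/res-D-pv-045/SketchG2Assembly.lean`, step H2 of the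
holder's roadmap for A5 «`ker δ = P(M, M)`»). Nothing of [claim: Hironaka2017] is used; AI-written,
weaker than expert review.

Setting: `X` integral, `T` a domain with `K(X) = Frac T` (`[Algebra T X.functionField]
[IsFractionRing T X.functionField]`, the convention of `…FullSheafEndLift`), the componentwise structure
map `ι_n := (Algebra.linearMap T K(X)).compLeft (Fin n) : T^n → K(X)^n`, and the full sheaf
`(T^n)~ := generatedSheaf (Fin n → K(X)) (range ι_n) = 𝒪_X · ι_n(T^n)` (p500643).

* `compLeft_algebraMap_injective`, `compLeft_algebraMap_single`, `span_range_compLeft_algebraMap` —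
  `ι_n` is injective, takes the standard basis to the standard basis, and has `K(X)`-spanning image;
* `isIso_presentation_pi` — pv-024's presentation `𝒪_X^n ⟶ (T^n)~` attached to the standard basis
  (p505917) is an isomorphism: the instance, in the `T`-LINEAR syntactic form used by `sheafHomOf`, of
  stub-4's `isIso_presentation_of_componentwise` (`…FullSheafFree`, for any componentwise structure map
  `T^n →+ K(X)^n` over `π : X → Spec T` with `algebraMap = baseToFunctionField π`);
* **`presentation_pi_comp_sheafHomOf`** — for a `T`-module `M` with `φ : M →ₗ[T] V` and elements
  `m : Fin n → M`, the presentation of `(T^n)~` followed by `sheafHomOf (Σ aₖ mₖ) : (T^n)~ ⟶ M~`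
  (p508318) is pv-024's presentation `𝒪_X^n ⟶ M~` attached to the `φ(mₖ)` (both are determined by the
  images of the basis sections, Mathlib `SheafOfModules.freeHomEquiv_symm_comp`).

Everything is proved; no named facts. [this work]
-/

-- single-problem summit: the doubled namespace component `ResolutionOfSingularities` is forced
set_option linter.dupNamespace false

noncomputable section

universe u

open CategoryTheory CategoryTheory.Limits AlgebraicGeometry TopologicalSpace Opposite
open Literature.AlgebraicGeometry.Resolution Literature.AlgebraicGeometry.Morphisms
open Literature.AlgebraicGeometry.Modules

namespace Summit.ResolutionOfSingularities.ResolutionOfSingularities.Theorems.NoZeno.SandwichCluster.FullSheaf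

/-! ## Linear algebra of `ι_n : T^n → K^n` -/

section LinearAlgebra

variable (T : Type*) [CommRing T] (K : Type*) [Field K] [Algebra T K]

/-- `ι_n` takes the standard basis vector `e_i` of `T^n` to the standard basis vector of `K^n`. [folklore] -/
theorem compLeft_algebraMap_single (n : ℕ) (i : Fin n) :
    (Algebra.linearMap T K).compLeft (Fin n) (Pi.single i 1) = Pi.single i 1 := by
  funext j
  change algebraMap T K (Pi.single (M := fun _ => T) i 1 j) = Pi.single (M := fun _ => K) i 1 j
  by_cases h : j = i
  · subst h; rw [Pi.single_eq_same, Pi.single_eq_same, map_one]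
  · rw [Pi.single_eq_of_ne h, Pi.single_eq_of_ne h, map_zero]

/-- `ι_n : T^n → K^n` is injective when `T → K` is (e.g. `K = Frac T`). [folklore] -/
theorem compLeft_algebraMap_injective [FaithfulSMul T K] (n : ℕ) :
    Function.Injective ((Algebra.linearMap T K).compLeft (Fin n)) := fun _ _ h =>
  funext fun j => FaithfulSMul.algebraMap_injective T K (congrFun h j)

/-- The image of `ι_n` spans `K^n` over `K`. [folklore] -/
theorem span_range_compLeft_algebraMap (n : ℕ) :
    Submodule.span K (Set.range ((Algebra.linearMap T K).compLeft (Fin n))) = ⊤ := by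
  refine eq_top_mono (Submodule.span_mono ?_) (Pi.basisFun K (Fin n)).span_eq
  rintro _ ⟨i, rfl⟩
  exact ⟨Pi.single i 1, by rw [Pi.basisFun_apply, compLeft_algebraMap_single]⟩

end LinearAlgebra

/-! ## `𝒪_X^n ≅ (T^n)~`, compatibly with the presentations of `M~` -/

section Sheaf

variable {X : Scheme.{u}} [IsIntegral X]
variable {T : Type u} [CommRing T] [Algebra T X.functionField]


variable (π : X ⟶ Spec (.of T)) (halg : algebraMap T X.functionField = baseToFunctionField π)
include halg

/-- **`𝒪_X^n ≅ (T^n)~`**: pv-024's presentation of the full sheaf of `T^n` attached to the standard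
basis is an isomorphism — stub-4's `isIso_presentation_of_componentwise` for the `T`-linear structure
map `ι_n` of an `X` over `Spec T` with `algebraMap = baseToFunctionField π`. [this work] -/
theorem isIso_presentation_pi (n : ℕ) :
    IsIso (presentation (X := X) (Fin n → X.functionField)
      (Set.range ((Algebra.linearMap T X.functionField).compLeft (Fin n)))
      (Set.rangeFactorization ((Algebra.linearMap T X.functionField).compLeft (Fin n)) ∘
        fun i => Pi.single i 1)) := by
  have h := isIso_presentation_of_componentwise π
    ((Algebra.linearMap T X.functionField).compLeft (Fin n)).toAddMonoidHom
    (fun v i => by rw [← halg]; rfl)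
  exact h

omit halg in
/-- **Compatibility of the two presentations.** For `φ : M →ₗ[T] V` and `m : Fin n → M`, the
isomorphism `𝒪_X^n ⟶ (T^n)~` followed by `sheafHomOf (a ↦ Σ aₖ mₖ) : (T^n)~ ⟶ M~` is the presentation
`𝒪_X^n ⟶ M~` attached to the `φ(mₖ)`: both take the basis section `eₖ` to `σ_{φ(mₖ)}`. [this work] -/
theorem presentation_pi_comp_sheafHomOf [IsDomain T] [IsFractionRing T X.functionField]
    {V : Type u} [AddCommGroup V] [Module X.functionField V]
    [Module T V] [IsScalarTower T X.functionField V] {M : Type*} [AddCommGroup M] [Module T M] (φ : M →ₗ[T] V) {n : ℕ} (m : Fin n → M) :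
    presentation (X := X) (Fin n → X.functionField)
        (Set.range ((Algebra.linearMap T X.functionField).compLeft (Fin n)))
        (Set.rangeFactorization ((Algebra.linearMap T X.functionField).compLeft (Fin n)) ∘
          fun i => Pi.single i 1) ≫
      sheafHomOf ((Algebra.linearMap T X.functionField).compLeft (Fin n)) φ
        (compLeft_algebraMap_injective T X.functionField n)
        (span_range_compLeft_algebraMap T X.functionField n) (Fintype.linearCombination T m) =
      presentation V (Set.range φ) (Set.rangeFactorization φ ∘ m) := by
  rw [presentation, presentation]
  erw [SheafOfModules.freeHomEquiv_symm_comp]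
  congr 1
  funext i
  apply Subtype.ext
  funext W
  change (sheafHomOf _ φ _ _ (Fintype.linearCombination T m)).app W.unop
      (ofMem (Fin n → X.functionField) _ W.unop
        (((Algebra.linearMap T X.functionField).compLeft (Fin n)) (Pi.single i.down 1))
        ⟨Pi.single i.down 1, rfl⟩) =
    ofMem V (Set.range φ) W.unop (φ (m i.down)) ⟨m i.down, rfl⟩
  rw [sheafHomOf_app_ofMem]
  exact section_ext V (Set.range φ) (funext fun y => by
    rw [fn_ofMem, fn_ofMem, Fintype.linearCombination_apply_single, one_smul])

end Sheaf

end Summit.ResolutionOfSingularities.ResolutionOfSingularities.Theorems.NoZeno.SandwichCluster.FullSheaf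

end
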